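import Literature.Barriers.QuantumAdvantage.NoiseThresholdUpperBounds
import Literature.Computability.QuantumComplexity.PauliGates
import Literature.Computability.QuantumComplexity.PauliReduce
import Literature.Computability.Cryptography.QubitRegisterProofs
import HarnessLib

/-!
# Kempe–Regev–Unger–de Wolf circuits in the Pauli picture (bridge lemmas)

The circuit model of `NoiseThresholdUpperBounds.lean` (`placeGate`, `pauliTwirl`,
`depolarizeWire(s)`, `QubitChannel`, `MixedUnitaryGate`, `NoisyGate`) expressed in the generic
Pauli-expansion vocabulary of `Literature/Computability/QuantumComplexity/Pauli*.lean`
(register `Fin n → Bool`, `tensorAll`, `pauliString`, `pauliCoeff`, `pauliWeight`), for the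
proof of Theorem 1 of Kempe–Regev–Unger–de Wolf, Quantum Inf. Comput. 10 (2010) 361–376
[KempeEtAl2010] in `NoiseThresholdUpperBoundsProofs.lean`:

* the one-line bridges `pauliX/Z/Y ↦ Pauli.mat X/Z/Y` (reindexing along `QReg 1 ≃ Bool`) and
  `placeGate (wire j) U = tensorAll (1,…,U♭,…,1)`;
* `pauliTwirl`/`depolarizeWire`/`depolarizeWires`/`QubitChannel.apply`/`MixedUnitaryGate.apply`
  in generic form;
* linearity of noisy gates (`NoisyGate.apply_sub`);
* strings that are the identity on a gate's block commute with it; hence the gate does not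
  change the Pauli coefficients off its block (`NoisyGate.pauliCoeff_apply_of_forall`) — the
  "consistent sets not touching the gate" of §3;
* (the induction steps of Lemma 7 for the model's gates and the proof of Theorem 1 are in
  `NoiseThresholdUpperBoundsProofs.lean`).

## References

* [KempeEtAl2010] J. Kempe, O. Regev, F. Unger, R. de Wolf, Quantum Inf. Comput. 10 (2010)
  361–376; arXiv:0802.1464, §1 (model), §3 (proof of Theorem 1).
-/

noncomputable section

open Matrix Finset Literature.Computability.Cryptography Literature.Computability.QuantumComplexity

namespace Literature.Barriers.QuantumAdvantage

variable {n k : ℕ}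

/-! ### One-qubit matrices: `QReg 1` versus `Bool` -/

/-- The Pauli `X` of `QubitRegister.lean`, reindexed along `QReg 1 ≃ Bool`, is `Pauli.mat X`.
[cite: KempeEtAl2010, §2] -/
theorem pauliX_submatrix : pauliX.submatrix (fun (b : Bool) (_ : Fin 1) => b) (fun b _ => b) = Pauli.mat .X := by
  ext a b
  simp only [Matrix.submatrix_apply, pauliX, Matrix.of_apply, Pauli.mat_X_apply]

/-- The Pauli `Z` of `QubitRegister.lean`, reindexed, is `Pauli.mat Z`. [cite: KempeEtAl2010, §2] -/
theorem pauliZ_submatrix : pauliZ.submatrix (fun (b : Bool) (_ : Fin 1) => b) (fun b _ => b) = Pauli.mat .Z := by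
  ext a b
  simp only [Matrix.submatrix_apply, pauliZ, Matrix.of_apply, Pauli.mat_Z_apply]
  have : ((fun _ : Fin 1 => a) = fun _ => b) ↔ a = b :=
    ⟨fun h => congrFun h 0, fun h => h ▸ rfl⟩
  simp only [this]

/-- Reindexing along `QReg 1 ≃ Bool` is multiplicative. [folklore] -/
theorem submatrix_bool_mul (M N : Matrix (QReg 1) (QReg 1) ℂ) :
    (M * N).submatrix (fun (b : Bool) (_ : Fin 1) => b) (fun b _ => b) =
      M.submatrix (fun (b : Bool) (_ : Fin 1) => b) (fun b _ => b) *
        N.submatrix (fun (b : Bool) (_ : Fin 1) => b) (fun b _ => b) := by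
  have h := Matrix.submatrix_mul_equiv M N (fun (b : Bool) (_ : Fin 1) => b)
    (Equiv.funUnique (Fin 1) Bool).symm (fun (b : Bool) (_ : Fin 1) => b)
  exact h.symm

/-- Reindexing the identity along `QReg 1 ≃ Bool`. [folklore] -/
theorem submatrix_bool_one :
    (1 : Matrix (QReg 1) (QReg 1) ℂ).submatrix (fun (b : Bool) (_ : Fin 1) => b) (fun b _ => b) = 1 :=
  Matrix.submatrix_one_equiv (Equiv.funUnique (Fin 1) Bool).symm

/-- The Pauli `Y = iXZ` of the barrier file, reindexed, is `Pauli.mat Y`. [cite: KempeEtAl2010, §2] -/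
theorem pauliY_submatrix : pauliY.submatrix (fun (b : Bool) (_ : Fin 1) => b) (fun b _ => b) = Pauli.mat .Y := by
  rw [pauliY, show (Complex.I • (pauliX * pauliZ)).submatrix (fun (b : Bool) (_ : Fin 1) => b) (fun b _ => b) =
    Complex.I • ((pauliX * pauliZ).submatrix (fun (b : Bool) (_ : Fin 1) => b) (fun b _ => b)) from rfl,
    submatrix_bool_mul, pauliX_submatrix, pauliZ_submatrix]
  ext a b
  simp only [Matrix.smul_apply, smul_eq_mul, Pauli.mul_apply_bool]
  cases a <;> cases b <;> simp

/-- Going back: a `Bool`-indexed matrix reindexed to `QReg 1` and then to `Bool` again. [folklore] -/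
theorem submatrix_qreg_submatrix_bool (A : Matrix Bool Bool ℂ) :
    (A.submatrix (fun x : QReg 1 => x 0) (fun x => x 0)).submatrix (fun (b : Bool) (_ : Fin 1) => b)
      (fun b _ => b) = A := by
  ext a b; rfl

/-! ### Placing a one-qubit matrix on wire `j` -/

/-- **`placeGate` on a single wire is a one-slot tensor product**:
`placeGate (wire j) U = 1 ⊗ … ⊗ U♭ ⊗ … ⊗ 1` with `U♭` the `Bool`-reindexed `U`.
[cite: KempeEtAl2010, §1 (one-qubit gates act on one wire)] -/
theorem placeGate_wire_eq_tensorAll (j : Fin n) (U : Matrix (QReg 1) (QReg 1) ℂ) :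
    placeGate (wire j) U = tensorAll (Function.update (fun _ : Fin n => (1 : Matrix Bool Bool ℂ)) j
      (U.submatrix (fun (b : Bool) (_ : Fin 1) => b) (fun b _ => b))) := by
  ext x y
  rw [placeGate_apply, tensorAll_update_apply, Matrix.submatrix_apply]
  have hx : x ∘ (wire j) = fun _ => x j := funext fun i => by simp
  have hy : y ∘ (wire j) = fun _ => y j := funext fun i => by simp
  have hrange : ∀ i : Fin n, i ∉ Set.range (wire j) ↔ i ≠ j := fun i => by
    simp [wire, eq_comm]
  have hprod : (∏ i ∈ Finset.univ.erase j, (1 : Matrix Bool Bool ℂ) (x i) (y i)) =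
      if ∀ i, i ≠ j → x i = y i then 1 else 0 := by
    simp only [Matrix.one_apply]
    rw [Finset.prod_boole]
    simp
  rw [hx, hy, hprod]
  by_cases h : ∀ i, i ≠ j → x i = y i
  · rw [if_pos h, if_pos fun i hi => h i ((hrange i).1 hi), mul_one]
  · rw [if_neg h, if_neg fun h' => h fun i hi => h' i ((hrange i).2 hi), mul_zero]

/-- The single-site Pauli string at `j` is the placement of the corresponding Pauli gate.
[cite: KempeEtAl2010, §2] -/
theorem pauliString_single_eq_placeGate (j : Fin n) (Q : Pauli) :
    pauliString (Function.update (fun _ : Fin n => Pauli.I) j Q) =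
      placeGate (wire j) ((Pauli.mat Q).submatrix (fun x : QReg 1 => x 0) (fun x => x 0)) := by
  rw [placeGate_wire_eq_tensorAll, pauliString_update_const]
  rfl

/-- The placements of `X, Y, Z` on wire `j` are the single-site strings. [cite: KempeEtAl2010, §2] -/
theorem placeGate_wire_pauli (j : Fin n) :
    placeGate (wire j) pauliX = pauliString (Function.update (fun _ : Fin n => Pauli.I) j .X) ∧
    placeGate (wire j) pauliY = pauliString (Function.update (fun _ : Fin n => Pauli.I) j .Y) ∧
    placeGate (wire j) pauliZ = pauliString (Function.update (fun _ : Fin n => Pauli.I) j .Z) := by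
  refine ⟨?_, ?_, ?_⟩ <;>
    rw [placeGate_wire_eq_tensorAll, pauliString_update_const]
  · rw [pauliX_submatrix]
  · rw [pauliY_submatrix]
  · rw [pauliZ_submatrix]

/-! ### Noise and gates in generic form -/

/-- **The barrier file's `pauliTwirl` is the uniform Pauli twirl** `¼ Σ_Q σ_Q^{(j)} M σ_Q^{(j)}`.
[cite: KempeEtAl2010, §1 (𝓔) and Observation 4] -/
theorem pauliTwirl_eq (j : Fin n) (M : MixedState n) :
    pauliTwirl j M = (1 / 4 : ℂ) • ∑ Q, pauliString (Function.update (fun _ : Fin n => Pauli.I) j Q) * M *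
      pauliString (Function.update (fun _ : Fin n => Pauli.I) j Q) := by
  obtain ⟨hX, hY, hZ⟩ := placeGate_wire_pauli j (n := n)
  rw [pauliTwirl, Pauli.sum_univ, conjBy, conjBy, conjBy, hX, hY, hZ, conjTranspose_pauliString,
    conjTranspose_pauliString, conjTranspose_pauliString]
  congr 1
  have hI : pauliString (Function.update (fun _ : Fin n => Pauli.I) j Pauli.I) = 1 := by
    rw [Function.update_eq_self, pauliString_const_I]
  rw [hI, Matrix.one_mul, Matrix.mul_one]

/-- `depolarizeWire` in generic form. [cite: KempeEtAl2010, §1 (𝓔(ρ) = (1−p)ρ + p I/2)] -/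
theorem depolarizeWire_eq (p : ℝ) (j : Fin n) (M : MixedState n) :
    depolarizeWire p j M = (1 - (p : ℂ)) • M + (p : ℂ) • ((1 / 4 : ℂ) • ∑ Q,
      pauliString (Function.update (fun _ : Fin n => Pauli.I) j Q) * M *
        pauliString (Function.update (fun _ : Fin n => Pauli.I) j Q)) := by
  rw [depolarizeWire, pauliTwirl_eq]
  push_cast
  rfl

/-- `depolarizeWires` is the left fold of `depolarizeWire` over the list. [cite: KempeEtAl2010, §1] -/
theorem depolarizeWires_eq_foldl (p : ℝ) (L : List (Fin n)) (M : MixedState n) :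
    depolarizeWires p L M = L.foldl (fun N j => (1 - (p : ℂ)) • N + (p : ℂ) • ((1 / 4 : ℂ) • ∑ Q,
      pauliString (Function.update (fun _ : Fin n => Pauli.I) j Q) * N *
        pauliString (Function.update (fun _ : Fin n => Pauli.I) j Q))) M := by
  induction L generalizing M with
  | nil => rfl
  | cons j L ih => rw [depolarizeWires, ih, List.foldl_cons, depolarizeWire_eq]

/-- `QubitChannel.apply` in generic form: conjugation by the one-slot tensor products of the
`Bool`-reindexed Kraus operators. [cite: KempeEtAl2010, §1 (arbitrary one-qubit gates)] -/
theorem QubitChannel.apply_eq (G : QubitChannel) (j : Fin n) (M : MixedState n) :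
    G.apply j M = ∑ i, tensorAll (Function.update (fun _ : Fin n => (1 : Matrix Bool Bool ℂ)) j
      ((G.kraus i).submatrix (fun (b : Bool) (_ : Fin 1) => b) (fun b _ => b))) * M *
      (tensorAll (Function.update (fun _ : Fin n => (1 : Matrix Bool Bool ℂ)) j
        ((G.kraus i).submatrix (fun (b : Bool) (_ : Fin 1) => b) (fun b _ => b))))ᴴ := by
  rw [QubitChannel.apply]
  refine Finset.sum_congr rfl fun i _ => ?_
  rw [conjBy, placeGate_wire_eq_tensorAll]

/-- The reindexed Kraus operators of a `QubitChannel` are a Kraus family: `Σ Kᵢ♭ᴴ Kᵢ♭ = 1`.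
[cite: KempeEtAl2010, §1 (trace-preserving)] -/
theorem QubitChannel.sum_kraus_bool (G : QubitChannel) :
    ∑ i, ((G.kraus i).submatrix (fun (b : Bool) (_ : Fin 1) => b) (fun b _ => b))ᴴ *
      (G.kraus i).submatrix (fun (b : Bool) (_ : Fin 1) => b) (fun b _ => b) = 1 := by
  have h := congrArg (fun A : Matrix (QReg 1) (QReg 1) ℂ => A.submatrix (fun (b : Bool) (_ : Fin 1) => b)
    (fun b _ => b)) G.sum_kraus
  simp only [submatrix_bool_one] at h
  rw [← h]
  have hsum : ∀ (s : Finset (Fin G.r)) (f : Fin G.r → Matrix (QReg 1) (QReg 1) ℂ),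
      (∑ i ∈ s, f i).submatrix (fun (b : Bool) (_ : Fin 1) => b) (fun b _ => b) =
        ∑ i ∈ s, (f i).submatrix (fun (b : Bool) (_ : Fin 1) => b) (fun b _ => b) := by
    intro s f
    ext a b
    simp only [Matrix.submatrix_apply, Matrix.sum_apply]
  rw [hsum]
  refine Finset.sum_congr rfl fun i _ => ?_
  rw [submatrix_bool_mul, Matrix.conjTranspose_submatrix]

/-- `MixedUnitaryGate.apply` in generic form. [cite: KempeEtAl2010, §1 (mixtures of unitaries)] -/
theorem MixedUnitaryGate.apply_eq (G : MixedUnitaryGate k) (e : Fin k ↪ Fin n) (M : MixedState n) :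
    G.apply e M = ∑ i, ((G.weight i : ℝ) : ℂ) • (placeGate e (G.unitary i) * M * (placeGate e (G.unitary i))ᴴ) :=
  rfl

/-- Placed unitaries are unitary: `Ũᴴ Ũ = 1`. [cite: KempeEtAl2010, §1] -/
theorem MixedUnitaryGate.conjTranspose_mul_self (G : MixedUnitaryGate k) (e : Fin k ↪ Fin n) (i : Fin G.r) :
    (placeGate e (G.unitary i))ᴴ * placeGate e (G.unitary i) = 1 := by
  have h := placeGate_mem_unitaryGroup_holds e (G.unitary_mem i)
  rw [Matrix.mem_unitaryGroup_iff', star_eq_conjTranspose] at h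
  exact h

/-! ### Commutation of off-block strings with placed gates -/

/-- A single-site Pauli off the block commutes with a placed gate.
[cite: KempeEtAl2010, §3 (consistent sets: gates act only on their block)] -/
theorem pauliString_single_mul_placeGate {j : Fin n} (e : Fin k ↪ Fin n) (hj : j ∉ Set.range e)
    (Q : Pauli) (U : Matrix (QReg k) (QReg k) ℂ) :
    pauliString (Function.update (fun _ : Fin n => Pauli.I) j Q) * placeGate e U =
      placeGate e U * pauliString (Function.update (fun _ : Fin n => Pauli.I) j Q) := by
  rw [pauliString_single_eq_placeGate]
  refine placeGate_comm_of_disjoint_holds (wire j) e ?_ _ U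
  rw [Set.disjoint_left]
  rintro _ ⟨i, rfl⟩ h
  exact hj (by simpa using h)

/-- A Pauli string as the (commuting) product of its single-site strings over a list of wires:
for a duplicate-free list `L`, `∏_{i ∈ L} σ_{S_i}^{(i)} = ⊗_i (S_i if i ∈ L else I)`. [folklore] -/
theorem prod_map_single_eq_tensorAll (S : Fin n → Pauli) {L : List (Fin n)} (hL : L.Nodup) :
    (L.map fun i => pauliString (Function.update (fun _ : Fin n => Pauli.I) i (S i))).prod =
      tensorAll fun i => if i ∈ L then (S i).mat else 1 := by
  induction L with
  | nil => simp only [List.map_nil, List.prod_nil, List.not_mem_nil, if_false]; exact tensorAll_one.symm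
  | cons j L ih =>
    rw [List.map_cons, List.prod_cons, ih (List.nodup_cons.1 hL).2, pauliString_update_const, tensorAll_mul]
    congr 1
    funext i
    by_cases h : i = j
    · subst h
      have : i ∉ L := (List.nodup_cons.1 hL).1
      simp [this]
    · simp [h]

/-- A string that is the identity on the block of a placed gate commutes with it.
[cite: KempeEtAl2010, §3 (consistent sets)] -/
theorem pauliString_mul_placeGate_of_forall (e : Fin k ↪ Fin n) {S : Fin n → Pauli}
    (hS : ∀ j, j ∈ Set.range e → S j = Pauli.I) (U : Matrix (QReg k) (QReg k) ℂ) :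
    pauliString S * placeGate e U = placeGate e U * pauliString S := by
  classical
  have hprod := prod_map_single_eq_tensorAll S (Finset.univ : Finset (Fin n)).nodup_toList
  simp only [Finset.mem_toList, Finset.mem_univ, if_true] at hprod
  rw [← pauliString_eq] at hprod
  rw [← hprod]
  refine (Commute.list_prod_right _ _ fun P hP => ?_).eq.symm
  rw [List.mem_map] at hP
  obtain ⟨i, -, rfl⟩ := hP
  by_cases hi : i ∈ Set.range e
  · rw [hS i hi, Function.update_eq_self, pauliString_const_I]
    exact Commute.one_right _
  · exact (pauliString_single_mul_placeGate e hi (S i) U).symm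

/-- Off-block coefficients are invariant under conjugation by a placed Kraus/unitary family:
if `S = I` on the block and `Σ K̃ᵢᴴ K̃ᵢ = 1` then `Tr(S · Σ K̃ᵢ M K̃ᵢᴴ) = Tr(S M)`.
[cite: KempeEtAl2010, §3 (the induction only revisits sets meeting the gate)] -/
theorem pauliCoeff_sum_conj_of_commute {κ : Type*} [Fintype κ] (K : κ → MixedState n) (w : κ → ℂ)
    (hK : ∑ i, w i • ((K i)ᴴ * K i) = 1) {S : Fin n → Pauli}
    (hcomm : ∀ i, pauliString S * K i = K i * pauliString S) (M : MixedState n) :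
    pauliCoeff (∑ i, w i • (K i * M * (K i)ᴴ)) S = pauliCoeff M S := by
  have h1 : ∀ i, (pauliString S * (K i * M * (K i)ᴴ)).trace = ((K i)ᴴ * K i * (pauliString S * M)).trace := by
    intro i
    rw [← Matrix.mul_assoc, ← Matrix.mul_assoc, hcomm i, trace_mul_cycle]
    simp only [Matrix.mul_assoc]
  have h2 : ∀ i, pauliCoeff (w i • (K i * M * (K i)ᴴ)) S = w i * ((K i)ᴴ * K i * (pauliString S * M)).trace := by
    intro i
    rw [pauliCoeff_smul, pauliCoeff_eq, h1 i]
  rw [pauliCoeff_sum]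
  simp only [h2]
  rw [pauliCoeff_eq]
  conv_rhs => rw [← Matrix.one_mul (pauliString S * M), ← hK, Finset.sum_mul, trace_sum]
  refine Finset.sum_congr rfl fun i _ => ?_
  rw [Matrix.smul_mul, trace_smul, smul_eq_mul]

/-- Conjugate transpose of a placed gate. [folklore] -/
theorem conjTranspose_placeGate (e : Fin k ↪ Fin n) (U : Matrix (QReg k) (QReg k) ℂ) :
    (placeGate e U)ᴴ = placeGate e Uᴴ := by
  ext x y
  rw [Matrix.conjTranspose_apply, placeGate_apply, placeGate_apply, Matrix.conjTranspose_apply]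
  by_cases h : ∀ i, i ∉ Set.range e → x i = y i
  · rw [if_pos h, if_pos fun i hi => (h i hi).symm]
  · rw [if_neg h, if_neg fun h' => h fun i hi => (h' i hi).symm, star_zero]

/-- Placement is additive over finite sums. [folklore] -/
theorem placeGate_sum {κ : Type*} (s : Finset κ) (e : Fin k ↪ Fin n) (f : κ → Matrix (QReg k) (QReg k) ℂ) :
    placeGate e (∑ i ∈ s, f i) = ∑ i ∈ s, placeGate e (f i) := by
  ext x y
  simp only [placeGate_apply, Matrix.sum_apply]
  split_ifs <;> simp

/-! ### Linearity of the gates -/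

/-- One-qubit channels are additive/subtractive. [folklore] -/
theorem QubitChannel.apply_sub (G : QubitChannel) (j : Fin n) (M N : MixedState n) :
    G.apply j (M - N) = G.apply j M - G.apply j N := by
  simp only [QubitChannel.apply, conjBy, Matrix.mul_sub, Matrix.sub_mul, Finset.sum_sub_distrib]

/-- Depolarizing noise is subtractive. [folklore] -/
theorem depolarizeWire_sub (p : ℝ) (j : Fin n) (M N : MixedState n) :
    depolarizeWire p j (M - N) = depolarizeWire p j M - depolarizeWire p j N := by
  simp only [depolarizeWire_eq, Matrix.mul_sub, Matrix.sub_mul, Finset.sum_sub_distrib, smul_sub]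
  abel

/-- Depolarizing noise on a list of wires is subtractive. [folklore] -/
theorem depolarizeWires_sub (p : ℝ) (L : List (Fin n)) (M N : MixedState n) :
    depolarizeWires p L (M - N) = depolarizeWires p L M - depolarizeWires p L N := by
  induction L generalizing M N with
  | nil => rfl
  | cons j L ih => rw [depolarizeWires, depolarizeWires, depolarizeWires, depolarizeWire_sub, ih]

/-- Mixed-unitary gates are subtractive. [folklore] -/
theorem MixedUnitaryGate.apply_sub (G : MixedUnitaryGate k) (e : Fin k ↪ Fin n) (M N : MixedState n) :
    G.apply e (M - N) = G.apply e M - G.apply e N := by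
  simp only [MixedUnitaryGate.apply, conjBy, Matrix.mul_sub, Matrix.sub_mul, Finset.sum_sub_distrib, smul_sub]

/-- **Noisy gates are linear** (here: subtractive), so the circuit acts on `δ = ρ − τ`
("we can view the noisy circuit as a linear operation", §3). [cite: KempeEtAl2010, §3 (first paragraph)] -/
theorem NoisyGate.apply_sub (g : NoisyGate n k) (M N : MixedState n) :
    g.apply (M - N) = g.apply M - g.apply N := by
  cases g with
  | mixedUnitary e G p => rw [NoisyGate.apply, NoisyGate.apply, NoisyGate.apply, depolarizeWires_sub,
      MixedUnitaryGate.apply_sub]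
  | qubit j G p => rw [NoisyGate.apply, NoisyGate.apply, NoisyGate.apply, QubitChannel.apply_sub,
      depolarizeWire_sub]

/-! ### Gates do not touch the coefficients off their block -/

/-- A one-qubit channel at `j` does not change `Tr(S M)` when `S_j = I`.
[cite: KempeEtAl2010, §3 (consistent sets)] -/
theorem QubitChannel.pauliCoeff_apply (G : QubitChannel) (j : Fin n) {S : Fin n → Pauli}
    (hS : S j = Pauli.I) (M : MixedState n) : pauliCoeff (G.apply j M) S = pauliCoeff M S := by
  have hS' : ∀ i, i ∈ Set.range (wire j) → S i = Pauli.I := by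
    rintro _ ⟨i, rfl⟩; simpa using hS
  have h := pauliCoeff_sum_conj_of_commute (fun i => placeGate (wire j) (G.kraus i)) (fun _ => (1 : ℂ))
    ?_ (fun i => pauliString_mul_placeGate_of_forall (wire j) hS' (G.kraus i)) M
  · simpa only [one_smul, QubitChannel.apply, conjBy] using h
  · have hmul : ∀ i, (placeGate (wire j) (G.kraus i))ᴴ * placeGate (wire j) (G.kraus i) =
        placeGate (wire j) ((G.kraus i)ᴴ * G.kraus i) := fun i => by
      rw [conjTranspose_placeGate, ← placeGate_mul_holds (wire j) ((G.kraus i)ᴴ) (G.kraus i)]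
    simp only [one_smul, hmul]
    rw [← placeGate_sum, G.sum_kraus, placeGate_one]

/-- A mixed-unitary gate on the block `e` does not change `Tr(S M)` when `S = I` on the block.
[cite: KempeEtAl2010, §3 (consistent sets)] -/
theorem MixedUnitaryGate.pauliCoeff_apply (G : MixedUnitaryGate k) (e : Fin k ↪ Fin n) {S : Fin n → Pauli}
    (hS : ∀ j, j ∈ Set.range e → S j = Pauli.I) (M : MixedState n) :
    pauliCoeff (G.apply e M) S = pauliCoeff M S := by
  rw [MixedUnitaryGate.apply_eq]
  refine pauliCoeff_sum_conj_of_commute (fun i => placeGate e (G.unitary i)) (fun i => ((G.weight i : ℝ) : ℂ))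
    ?_ (fun i => pauliString_mul_placeGate_of_forall e hS (G.unitary i)) M
  simp only [MixedUnitaryGate.conjTranspose_mul_self, ← Finset.sum_smul]
  rw [← Complex.ofReal_sum, G.sum_weight, Complex.ofReal_one, one_smul]

/-- Depolarizing a list of wires on which `S` is the identity does not change `Tr(S M)`.
[cite: KempeEtAl2010, Observation 4] -/
theorem pauliCoeff_depolarizeWires_of_forall (p : ℝ) {L : List (Fin n)} {S : Fin n → Pauli}
    (hS : ∀ j ∈ L, S j = Pauli.I) (M : MixedState n) : pauliCoeff (depolarizeWires p L M) S = pauliCoeff M S := by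
  rw [depolarizeWires_eq_foldl, pauliCoeff_foldl_depolarize, List.prod_eq_one, one_mul]
  intro c hc
  rw [List.mem_map] at hc
  obtain ⟨j, hj, rfl⟩ := hc
  rw [if_pos (hS j hj)]

/-- **Off-block invariance**: a noisy gate does not change the Pauli coefficients of strings
that are the identity on its block. [cite: KempeEtAl2010, §3 (consistent sets)] -/
theorem NoisyGate.pauliCoeff_apply_of_forall (g : NoisyGate n k) {S : Fin n → Pauli}
    (hS : ∀ j ∈ g.wires, S j = Pauli.I) (M : MixedState n) : pauliCoeff (g.apply M) S = pauliCoeff M S := by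
  cases g with
  | mixedUnitary e G p =>
    have hS' : ∀ j, j ∈ Set.range e → S j = Pauli.I := by
      rintro _ ⟨i, rfl⟩
      exact hS _ (by simp [NoisyGate.wires])
    rw [NoisyGate.apply, MixedUnitaryGate.pauliCoeff_apply G e hS', pauliCoeff_depolarizeWires_of_forall]
    intro j hj
    rw [List.mem_map] at hj
    obtain ⟨i, -, rfl⟩ := hj
    exact hS' _ ⟨i, rfl⟩
  | qubit j G p =>
    have hj : S j = Pauli.I := hS j (by simp [NoisyGate.wires])
    rw [NoisyGate.apply, depolarizeWire_eq, pauliCoeff_depolarize, if_pos hj, one_mul,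
      QubitChannel.pauliCoeff_apply G j hj]

/-- Consequently a noisy gate does not change the Pauli weight of a wire set disjoint from its
block. [cite: KempeEtAl2010, §3] -/
theorem NoisyGate.pauliWeight_apply_of_disjoint (g : NoisyGate n k) {W : Finset (Fin n)}
    (hW : Disjoint W g.wires) (M : MixedState n) : pauliWeight (g.apply M) W = pauliWeight M W := by
  rw [pauliWeight_eq, pauliWeight_eq]
  refine Finset.sum_congr rfl fun S hS => ?_
  rw [g.pauliCoeff_apply_of_forall fun j hj => mem_stringsOn.1 hS j (Finset.disjoint_right.1 hW hj)]

end Literature.Barriers.QuantumAdvantage
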